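import Literature.AnabelianGeometry.SemiGraphs.UniversalCoveringOver
import Literature.AnabelianGeometry.SemiGraphs.OrbitGraphMap

/-!
# The image of a morphism of coverings is a union of components ([SemiAnbd] §3 p. 37) — proofs

Proof-only file.  For a morphism `f : X ⟶ Y` of `B^cov(𝒢)`, the set of points of `Y` in the image
of `f` is stable under the adjacency relation in both directions (equivariance; compatibility with
the gluings and their inverses), hence a union of connected components: if a point `p` of `Y` is
in the image, so is every point of the component of `p` (`CovHom.mem_image_of_sameComponent`).
Used for the universal morphisms `𝒢_{∞,n} ⟶ (component)`, which are therefore surjective on points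
([SemiAnbd] Prop. 3.6 (ii), p. 38).
-/

namespace Literature.AnabelianGeometry.SemiGraphs

namespace ProfiniteSemiGraph

open CategoryTheory

universe u

variable {𝒢 : ProfiniteSemiGraph.{u}} {X Y : CovObj 𝒢} (f : X ⟶ Y)

/-- "The point `q` of `Y` is in the image of `f`." [cite: MochizukiSemiAnbd2006, Def 3.5(ii) p.37] -/
private def InImage : Y.Point → Prop
  | Sum.inl ⟨v, y⟩ => ∃ x : (X.SV v).obj.V, (f.fV v).hom.hom x = y
  | Sum.inr ⟨e, y⟩ => ∃ x : (X.SE e).obj.V, (f.fE e).hom.hom x = y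

/-- The image is stable under adjacency in both directions. [folklore] -/
private theorem inImage_iff_of_adj {p q : Y.Point} (h : Y.Adj p q) : InImage f p ↔ InImage f q := by
  cases h with
  | vertex v g y =>
    change (∃ x, (f.fV v).hom.hom x = y) ↔ ∃ x, (f.fV v).hom.hom x = (Y.SV v).obj.ρ g y
    constructor
    · rintro ⟨x, rfl⟩
      exact ⟨(X.SV v).obj.ρ g x, CovHom.fV_ρ f v g x⟩
    · rintro ⟨x, hx⟩
      refine ⟨(X.SV v).obj.ρ g⁻¹ x, ?_⟩
      rw [CovHom.fV_ρ, hx]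
      change ((Y.SV v).obj.ρ g ≫ (Y.SV v).obj.ρ g⁻¹) y = y
      rw [← End.mul_def, ← map_mul, inv_mul_cancel, map_one]
      rfl
  | edge e g y =>
    change (∃ x, (f.fE e).hom.hom x = y) ↔ ∃ x, (f.fE e).hom.hom x = (Y.SE e).obj.ρ g y
    constructor
    · rintro ⟨x, rfl⟩
      exact ⟨(X.SE e).obj.ρ g x, CovHom.fE_ρ f e g x⟩
    · rintro ⟨x, hx⟩
      refine ⟨(X.SE e).obj.ρ g⁻¹ x, ?_⟩
      rw [CovHom.fE_ρ, hx]
      change ((Y.SE e).obj.ρ g ≫ (Y.SE e).obj.ρ g⁻¹) y = y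
      rw [← End.mul_def, ← map_mul, inv_mul_cancel, map_one]
      rfl
  | glue b v hb y =>
    change (∃ x, (f.fE _).hom.hom x = y) ↔ ∃ x, (f.fV v).hom.hom x = (Y.glue b v hb).hom.hom.hom y
    constructor
    · rintro ⟨x, rfl⟩
      exact ⟨(X.glue b v hb).hom.hom.hom x, (CovHom.glue_fE f b v hb x).symm⟩
    · rintro ⟨x, hx⟩
      refine ⟨(X.glue b v hb).inv.hom.hom x, ?_⟩
      apply Function.LeftInverse.injective (Y.glue_inv_hom b v hb)
      rw [CovHom.glue_fE, X.glue_hom_inv, hx]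

/-- **If a point of `Y` is in the image of `f : X ⟶ Y`, so is its whole component.**
[cite: MochizukiSemiAnbd2006, Def 3.5(ii) p.37] -/
theorem CovHom.exists_preimage_of_sameComponent {v₀ : 𝒢.graph.Vertex} (x₀ : (X.SV v₀).obj.V)
    {v : 𝒢.graph.Vertex} (y : (Y.SV v).obj.V)
    (h : Y.SameComponent (Sum.inl ⟨v₀, (f.fV v₀).hom.hom x₀⟩) (Sum.inl ⟨v, y⟩)) :
    ∃ x : (X.SV v).obj.V, (f.fV v).hom.hom x = y := by
  have key : ∀ {p q : Y.Point}, Y.SameComponent p q → (InImage f p ↔ InImage f q) := by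
    intro p q hpq
    induction hpq with
    | rel a b hab => exact inImage_iff_of_adj f hab
    | refl a => exact Iff.rfl
    | symm a b _ ih => exact ih.symm
    | trans a b c _ _ ih1 ih2 => exact ih1.trans ih2
  have h0 : InImage f (Sum.inl ⟨v₀, (f.fV v₀).hom.hom x₀⟩) := ⟨x₀, rfl⟩
  exact (key h).mp h0

/-- Edge version. [cite: MochizukiSemiAnbd2006, Def 3.5(ii) p.37] -/
theorem CovHom.exists_preimage_of_sameComponent_edge {v₀ : 𝒢.graph.Vertex} (x₀ : (X.SV v₀).obj.V)
    {e : 𝒢.graph.Edge} (y : (Y.SE e).obj.V)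
    (h : Y.SameComponent (Sum.inl ⟨v₀, (f.fV v₀).hom.hom x₀⟩) (Sum.inr ⟨e, y⟩)) :
    ∃ x : (X.SE e).obj.V, (f.fE e).hom.hom x = y := by
  have key : ∀ {p q : Y.Point}, Y.SameComponent p q → (InImage f p ↔ InImage f q) := by
    intro p q hpq
    induction hpq with
    | rel a b hab => exact inImage_iff_of_adj f hab
    | refl a => exact Iff.rfl
    | symm a b _ ih => exact ih.symm
    | trans a b c _ _ ih1 ih2 => exact ih1.trans ih2
  have h0 : InImage f (Sum.inl ⟨v₀, (f.fV v₀).hom.hom x₀⟩) := ⟨x₀, rfl⟩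
  exact (key h).mp h0

end ProfiniteSemiGraph

end Literature.AnabelianGeometry.SemiGraphs
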